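import Summits.FinalStateConjecture.FinalStateConjecture.Theorems.BartnikGapSettlingBondiBartnikRigidityMarchingLemmaLevelData
import Summits.FinalStateConjecture.FinalStateConjecture.Theorems.BartnikGapSettlingBondiBartnikRigidityRouteMarchingDefs
import Summits.FinalStateConjecture.FinalStateConjecture.Theorems.BartnikGapSettlingBondiBartnikRigiditySlabCauchyRigidityFactorisation
import Literature.Geometry.Lorentzian.HypersurfaceNaturality
import Literature.Geometry.Lorentzian.CauchyDevelopmentRestrict
import Literature.Geometry.Lorentzian.CauchyDevelopmentOneJet
import Literature.Topology.FourManifolds.ImmersionCriterion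
import HarnessLib

/-!
# K2b-5 `stub_marchingLemma`, brick 5: the hypersurface datum carried by an EXACT chart — line
# `direct-method-on-the-cone` (crux `BondiBartnikRigidity`, stmt-FinalStateConjecture-10807)

The `𝒱`-side of the datum of one marching step (report K2b-a2 §4: "its image … carries the
`τ`-translate of `Kerr.data`").  Let `Ψ` be an EXACT chart of the collar background
`B = starBackground Λ c M a (r_a ∘ (Λ,c)⁻¹)` on the pull-back `pullK Q` of an open Kerr-side set `Q`
into a spacetime `𝒮` — smooth, deviation `0`, pushing the Kerr-star orientation `ΛV` to future-directed
vectors —, `lab : z ↦ Λz + c` the rest-frame identification `Kerr.region a M → B.domain`, and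
`j_K : y ↦ (σ, y)` the level-`σ` embedding of a connected slice piece `N ⊆ E3` INTO `Q`, with normal
`ν_K = Kerr.sliceNormal ∘ ι`.  Then `Φ = Ψ ∘ lab` is an isometric immersion of `(Q, g_{M,a})` into `𝒮`
in chart form (`val_mfderiv_chart`: `g(dΦ u, dΦ u') = g_{M,a}(u, u')`, from deviation `0` and
`boostedKerrBilin_apply`), and the hypersurface `j = Φ ∘ j_K` with the field `ν = dΦ ν_K` satisfies the
four hypotheses of the hypersurface localisation engine
`CaptureSufficesC2.Sketch.stub_hypersurfaceMGHDRealised_of_choquetBruhatGeroch` for the sub-datum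
`D' = ι^* Kerr.data`:

* `chart_induced_h` — `j^* g = D'.h` (chain rule + chart isometry + `KerrLevel.level_induced_h`);
* `chart_isFutureUnitNormal` — `ν` is the future unit normal of `j` (orientation clause of `Ψ`);
* `chart_isSmoothEmbedding` — `j` is a smooth embedding (injective `dΦ` by nondegeneracy of `g_{M,a}`;
  `Ψ|pullK Q` an open embedding);
* `chart_induced_k` — `K^{g}_{j, ν} = D'.k`: NATURALITY of the second fundamental form under the
  equidimensional immersion `Φ|Q` (`PseudoRiemannianMetric.secondFundamentalForm_comap`: the pulled-back
  metric `Φ^* g` on `Q` IS `g_{M,a}|Q`), then `KerrLevel.level_induced_k`.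

References: O'Neill 1983, Ch. 3, Prop. 3.59, pp. 90–91; Ch. 4, Lemma 4.4 [ONeill1983]; Hawking–Ellis 1973,
§7.6 [HawkingEllis1973CUP].  No definitions, no named facts.
-/

noncomputable section

-- D-0017: single-problem summit, `Summit.<S>.<S>.…` by design (cf. lakefile `weak.linter.dupNamespace`).
set_option linter.dupNamespace false
-- instance search through the nested operator types of the Kerr chart facts
set_option maxSynthPendingDepth 3

open Set Filter Function Topology TopologicalSpace Bundle
open Literature.Geometry.Lorentzian
open scoped Manifold ContDiff Topology ENNReal

namespace Summit.FinalStateConjecture.FinalStateConjecture.Theorems.BondiBartnikRigidity.DirectMethod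

namespace ChartData

open F1Route (lab_poincareInv poincareInv_lab)

variable {𝒮 : Spacetime.{0} 4} {mo : lorentzGroup × E4} {M a : ℝ} {B : ModelBackground}
  {Ψ : B.domain → 𝒮.carrier} {lab : Kerr.region a M → B.domain} {Q : Set (Kerr.region a M)}

/-! ### The rest-frame identification and the chart as a map of the Kerr chart -/

set_option synthInstance.maxHeartbeats 200000 in
/-- Exactness at order `0` on `pullK Q`: the deviation vanishes at its points. [folklore] -/
theorem deviation_eq_zero_of_exact {x : B.domain}
    (hd : supCkENorm (Subtype.val '' pullK mo M a B Q) 0 (𝒮.deviationExtend B Ψ) ≤ 0)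
    (hx : x ∈ pullK mo M a B Q) : 𝒮.deviation B Ψ x = 0 := by
  have hle := (enorm_iteratedFDeriv_le_supCkENorm (k := 0) (m := 0) le_rfl
    (mem_image_of_mem Subtype.val hx) (𝒮.deviationExtend B Ψ)).trans hd
  have h0 : iteratedFDeriv ℝ 0 (𝒮.deviationExtend B Ψ) x.1 = 0 := by
    have := le_antisymm hle zero_le
    rwa [enorm_eq_zero] at this
  have h1 := congrArg (fun F => F Fin.elim0) h0
  simp only [iteratedFDeriv_zero_apply, Spacetime.deviationExtend_coe] at h1
  exact h1

/-- `lab z = Λ z + c` lies over `z`: `Λ⁻¹(lab z − c) = z`, so `lab z ∈ pullK S ↔ z ∈ S`. [folklore] -/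
theorem lab_mem_pullK_iff (hlab : ∀ z, (lab z : E4) = (mo.1 : E4 ≃L[ℝ] E4) z.1 + mo.2)
    {S : Set (Kerr.region a M)} (z : Kerr.region a M) : lab z ∈ pullK mo M a B S ↔ z ∈ S := by
  have hP : poincareInv mo.1 mo.2 (lab z).1 = z.1 := by rw [hlab, poincareInv_lab]
  constructor
  · rintro ⟨h, hS⟩
    have : (⟨poincareInv mo.1 mo.2 (lab z).1, h⟩ : Kerr.region a M) = z := Subtype.ext hP
    rwa [this] at hS
  · intro hz
    refine ⟨by rw [hP]; exact z.2, ?_⟩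
    have : (⟨poincareInv mo.1 mo.2 (lab z).1, by rw [hP]; exact z.2⟩ : Kerr.region a M) = z := Subtype.ext hP
    rw [this]; exact hz

/-- `lab` is smooth with differential `Λ`. [folklore] -/
theorem contMDiff_lab (hlab : ∀ z, (lab z : E4) = (mo.1 : E4 ≃L[ℝ] E4) z.1 + mo.2) :
    ContMDiff 𝓘(ℝ, E4) 𝓘(ℝ, E4) ∞ lab ∧
      ∀ z, mfderiv 𝓘(ℝ, E4) 𝓘(ℝ, E4) lab z = ((mo.1 : E4 ≃L[ℝ] E4) : E4 →L[ℝ] E4) := by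
  have hrep : ∀ z : Kerr.region a M, (lab z : E4) = (fun x : E4 => (mo.1 : E4 ≃L[ℝ] E4) x + mo.2) z.1 := hlab
  have hcd : ContDiff ℝ ∞ (fun x : E4 => (mo.1 : E4 ≃L[ℝ] E4) x + mo.2) :=
    ((mo.1 : E4 ≃L[ℝ] E4) : E4 →L[ℝ] E4).contDiff.add contDiff_const
  have hs : ContMDiff 𝓘(ℝ, E4) 𝓘(ℝ, E4) ∞ (fun z : Kerr.region a M => (lab z : E4)) := fun z =>
    (OpensChart.contMDiffAt_iff z (fun z : Kerr.region a M => (lab z : E4))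
      (fun x : E4 => (mo.1 : E4 ≃L[ℝ] E4) x + mo.2) hrep).2 hcd.contDiffAt
  refine ⟨(ContMDiff.subtypeVal_comp_iff _ _).1 hs, fun z => ?_⟩
  have h1 : MDifferentiableAt 𝓘(ℝ, E4) 𝓘(ℝ, E4) (fun z : Kerr.region a M => (lab z : E4)) z :=
    (hs z).mdifferentiableAt (by simp)
  rw [OpensChart.mfderiv_codRestrict (f := fun z : Kerr.region a M => (lab z : E4)) (fun _ => rfl) h1,
    OpensChart.mfderiv_eq z (fun z : Kerr.region a M => (lab z : E4))
      (fun x : E4 => (mo.1 : E4 ≃L[ℝ] E4) x + mo.2) hrep ((hcd.differentiable (by simp)).differentiableAt)]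
  exact ((((mo.1 : E4 ≃L[ℝ] E4) : E4 →L[ℝ] E4).hasFDerivAt).add_const mo.2).fderiv

/-- **The chart is smooth on `Q` as a map of the Kerr chart, with `d(Ψ ∘ lab) u = dΨ (Λ u)`.**
[folklore] -/
theorem contMDiffAt_chart (hlab : ∀ z, (lab z : E4) = (mo.1 : E4 ≃L[ℝ] E4) z.1 + mo.2)
    (hQ : IsOpen Q) (hB : B = starBackground mo.1 mo.2 M a (fun x => Kerr.radius a (poincareInv mo.1 mo.2 x)))
    (hs : ContMDiffOn 𝓘(ℝ, E4) (𝓡 4) ∞ Ψ (pullK mo M a B Q)) {z : Kerr.region a M} (hz : z ∈ Q) :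
    ContMDiffAt 𝓘(ℝ, E4) (𝓡 4) ∞ (Ψ ∘ lab) z ∧
      ∀ u : E4, mfderiv 𝓘(ℝ, E4) (𝓡 4) (Ψ ∘ lab) z u =
        mfderiv 𝓘(ℝ, E4) (𝓡 4) Ψ (lab z) ((mo.1 : E4 ≃L[ℝ] E4) u) := by
  obtain ⟨hls, hld⟩ := contMDiff_lab hlab
  have hΨ : ContMDiffAt 𝓘(ℝ, E4) (𝓡 4) ∞ Ψ (lab z) :=
    (hs _ ((lab_mem_pullK_iff hlab z).2 hz)).contMDiffAt
      ((K2Route.isOpen_pullK_of_eq hB hQ).mem_nhds ((lab_mem_pullK_iff hlab z).2 hz))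
  refine ⟨hΨ.comp z (hls z), fun u => ?_⟩
  rw [mfderiv_comp z (hΨ.mdifferentiableAt (by simp)) ((hls z).mdifferentiableAt (by simp)), hld z]
  rfl

/-- **The exact chart is an isometric immersion of `(Q, g_{M,a})` in chart form**:
`g(d(Ψ∘lab) u, d(Ψ∘lab) u') = g_{M,a}(z)(u, u')` at `z ∈ Q` — deviation `0` at `lab z` and
`boostedKerrBilin Λ c (lab z)(Λu, Λu') = g_{M,a}(z)(u, u')`. [cite: ONeill1983, Ch. 3, pp. 90–91] -/
theorem val_mfderiv_chart (hlab : ∀ z, (lab z : E4) = (mo.1 : E4 ≃L[ℝ] E4) z.1 + mo.2)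
    (hQ : IsOpen Q) (hB : B = starBackground mo.1 mo.2 M a (fun x => Kerr.radius a (poincareInv mo.1 mo.2 x)))
    (hs : ContMDiffOn 𝓘(ℝ, E4) (𝓡 4) ∞ Ψ (pullK mo M a B Q))
    (hd : supCkENorm (Subtype.val '' pullK mo M a B Q) 0 (𝒮.deviationExtend B Ψ) ≤ 0)
    {z : Kerr.region a M} (hz : z ∈ Q) (u u' : E4) :
    𝒮.metric.val ((Ψ ∘ lab) z) (mfderiv 𝓘(ℝ, E4) (𝓡 4) (Ψ ∘ lab) z u)
      (mfderiv 𝓘(ℝ, E4) (𝓡 4) (Ψ ∘ lab) z u') = Kerr.bilin M a z.1 u u' := by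
  obtain ⟨-, hdΦ⟩ := contMDiffAt_chart hlab hQ hB hs hz
  have hdev := deviation_eq_zero_of_exact hd ((lab_mem_pullK_iff hlab z).2 hz)
  have h : 𝒮.deviation B Ψ (lab z) ((mo.1 : E4 ≃L[ℝ] E4) u) ((mo.1 : E4 ≃L[ℝ] E4) u') = 0 := by
    rw [hdev]; rfl
  rw [Spacetime.deviation_apply, sub_eq_zero] at h
  have hbil : B.bilin = boostedKerrBilin mo.1 mo.2 M a := by rw [hB]; rfl
  rw [hdΦ u, hdΦ u', Function.comp_apply]
  refine h.trans ?_
  rw [hbil, boostedKerrBilin_apply, hlab, poincareInv_lab]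
  simp

/-- The chart has injective differentials on `Q` (isometric and `g_{M,a}` nondegenerate). [folklore] -/
theorem eq_zero_of_mfderiv_chart_eq_zero (hlab : ∀ z, (lab z : E4) = (mo.1 : E4 ≃L[ℝ] E4) z.1 + mo.2)
    (hQ : IsOpen Q) (hB : B = starBackground mo.1 mo.2 M a (fun x => Kerr.radius a (poincareInv mo.1 mo.2 x)))
    (hs : ContMDiffOn 𝓘(ℝ, E4) (𝓡 4) ∞ Ψ (pullK mo M a B Q))
    (hd : supCkENorm (Subtype.val '' pullK mo M a B Q) 0 (𝒮.deviationExtend B Ψ) ≤ 0)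
    {z : Kerr.region a M} (hz : z ∈ Q) {u : E4} (hu : mfderiv 𝓘(ℝ, E4) (𝓡 4) (Ψ ∘ lab) z u = 0) :
    u = 0 := by
  refine Kerr.bilin_nondegenerate M a (Kerr.radius_pos_of_mem_region z.2) u fun w => ?_
  rw [← val_mfderiv_chart hlab hQ hB hs hd hz u w, hu, map_zero]; rfl

/-! ### The hypersurface `j = Ψ ∘ lab ∘ j_K` and its normal `ν = dΨ (Λ ν_K)` -/

section Hypersurface

variable [Kerr.Facts] [Kerr.SliceFacts] {σ : ℝ} {N : Opens E3} [ConnectedSpace N]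
  {jK : N → Kerr.region a M} {νK : NormalField 𝓘(ℝ, E4) jK}

/-- **The induced metric of `j` is the metric of the sub-datum**: `j^* g = (ι^* Kerr.data).h`.
[cite: ONeill1983, Ch. 3, Prop. 3.59] -/
theorem chart_induced_h (hM : 0 ≤ M) (hlab : ∀ z, (lab z : E4) = (mo.1 : E4 ≃L[ℝ] E4) z.1 + mo.2)
    (hQ : IsOpen Q) (hB : B = starBackground mo.1 mo.2 M a (fun x => Kerr.radius a (poincareInv mo.1 mo.2 x)))
    (hs : ContMDiffOn 𝓘(ℝ, E4) (𝓡 4) ∞ Ψ (pullK mo M a B Q))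
    (hd : supCkENorm (Subtype.val '' pullK mo M a B Q) 0 (𝒮.deviationExtend B Ψ) ≤ 0)
    (hN : N ≤ Kerr.slice a M) (hjK : ∀ y, (jK y : E4) = E4.ofTimeSpace σ (y : E3)) (hjQ : ∀ y, jK y ∈ Q)
    (y : N) :
    pullbackBilin (I := 𝓡 4) (I' := 𝓡 3) (Ψ ∘ lab ∘ jK) 𝒮.metric.val y =
      ((Kerr.data M a M hM).comap (Opens.inclusion hN) (contMDiff_inclusion hN)
        (KerrLevel.injective_mfderiv_inclusion hN)).h.inner y := by
  have hjKd : MDifferentiableAt 𝓘(ℝ, E3) 𝓘(ℝ, E4) jK y :=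
    ((KerrLevel.level_isSmoothEmbedding hM σ hN hjK).contMDiff y).mdifferentiableAt (by simp)
  obtain ⟨hΦ, -⟩ := contMDiffAt_chart hlab hQ hB hs (hjQ y)
  rw [← KerrLevel.level_induced_h hM σ hN hjK y]
  ext v w
  rw [pullbackBilin_apply, pullbackBilin_apply, show Ψ ∘ lab ∘ jK = (Ψ ∘ lab) ∘ jK from rfl,
    mfderiv_comp y (hΦ.mdifferentiableAt (by simp)) hjKd]
  exact val_mfderiv_chart hlab hQ hB hs hd (hjQ y) _ _

/-- **`ν = dΨ (Λ ν_K)` is the future unit normal of `j`** — orthogonality and normalisation by the chart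
isometry (`KerrLevel.level_isFutureUnitNormal`), future-directedness from the orientation clause of
`Ψ` (`ν_K` is a positive multiple of the Kerr-star orientation `V`, which is `t*`-invariant).
[cite: ONeill1983, Ch. 3, Prop. 3.59] -/
theorem chart_isFutureUnitNormal (hM : 0 ≤ M) (hlab : ∀ z, (lab z : E4) = (mo.1 : E4 ≃L[ℝ] E4) z.1 + mo.2)
    (hQ : IsOpen Q) (hB : B = starBackground mo.1 mo.2 M a (fun x => Kerr.radius a (poincareInv mo.1 mo.2 x)))
    (hs : ContMDiffOn 𝓘(ℝ, E4) (𝓡 4) ∞ Ψ (pullK mo M a B Q))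
    (hd : supCkENorm (Subtype.val '' pullK mo M a B Q) 0 (𝒮.deviationExtend B Ψ) ≤ 0)
    (htop : ∀ x ∈ pullK mo M a B Q, 𝒮.timeOrientation.IsFutureDirected
      (mfderiv 𝓘(ℝ, E4) (𝓡 4) Ψ x ((mo.1 : E4 ≃L[ℝ] E4) (Kerr.timeVector M a (poincareInv mo.1 mo.2 x.1)))))
    (hN : N ≤ Kerr.slice a M) (hjK : ∀ y, (jK y : E4) = E4.ofTimeSpace σ (y : E3)) (hjQ : ∀ y, jK y ∈ Q)
    (hνK : ∀ y, νK y = Kerr.sliceNormal M a M (Opens.inclusion hN y)) :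
    𝒮.metric.IsFutureUnitNormal (𝓡 3) 𝒮.timeOrientation (Ψ ∘ lab ∘ jK)
      (fun y => mfderiv 𝓘(ℝ, E4) (𝓡 4) Ψ (lab (jK y)) ((mo.1 : E4 ≃L[ℝ] E4) (νK y))) := by
  have hK := KerrLevel.level_isFutureUnitNormal hM σ hN hjK hνK
  have hjKd : ∀ y, MDifferentiableAt 𝓘(ℝ, E3) 𝓘(ℝ, E4) jK y := fun y =>
    ((KerrLevel.level_isSmoothEmbedding hM σ hN hjK).contMDiff y).mdifferentiableAt (by simp)
  -- `ν = d(Ψ ∘ lab) ν_K`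
  have hνfun : (fun y => mfderiv 𝓘(ℝ, E4) (𝓡 4) Ψ (lab (jK y)) ((mo.1 : E4 ≃L[ℝ] E4) (νK y))) =
      fun y => mfderiv 𝓘(ℝ, E4) (𝓡 4) (Ψ ∘ lab) (jK y) (νK y) :=
    funext fun y => ((contMDiffAt_chart hlab hQ hB hs (hjQ y)).2 (νK y)).symm
  rw [hνfun]
  refine ⟨⟨fun y v => ?_, fun y => ?_⟩, fun y => ?_⟩
  · obtain ⟨hΦ, -⟩ := contMDiffAt_chart hlab hQ hB hs (hjQ y)
    change 𝒮.metric.val ((Ψ ∘ lab) (jK y)) (mfderiv 𝓘(ℝ, E4) (𝓡 4) (Ψ ∘ lab) (jK y) (νK y))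
      (mfderiv (𝓡 3) (𝓡 4) ((Ψ ∘ lab) ∘ jK) y v) = 0
    rw [mfderiv_comp y (hΦ.mdifferentiableAt (by simp)) (hjKd y)]
    exact (val_mfderiv_chart hlab hQ hB hs hd (hjQ y) _ _).trans (hK.1.1 y v)
  · exact (val_mfderiv_chart hlab hQ hB hs hd (hjQ y) _ _).trans (hK.1.2 y)
  · -- `ν_K y = c • V` with `c > 0`, and `dΨ (Λ V)` is future-directed by the orientation clause
    obtain ⟨-, hdΦ⟩ := contMDiffAt_chart hlab hQ hB hs (hjQ y)
    have hmem : lab (jK y) ∈ pullK mo M a B Q := (lab_mem_pullK_iff hlab (jK y)).2 (hjQ y)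
    have hP : poincareInv mo.1 mo.2 (lab (jK y)).1 = (jK y).1 := by rw [hlab, poincareInv_lab]
    have hV := htop _ hmem
    rw [hP] at hV
    set c : ℝ := (√(1 + 2 * Kerr.scalarH M a (E4.ofTimeSpace 0 (y : E3))))⁻¹ with hc
    have hcpos : 0 < c := by
      have hpos : 0 < 1 + 2 * Kerr.scalarH M a (E4.ofTimeSpace 0 (y : E3)) := by
        linarith [Kerr.scalarH_nonneg hM a (E4.ofTimeSpace 0 (y : E3))]
      exact inv_pos.2 (Real.sqrt_pos.2 hpos)
    have hx : ((jK y) : E4) = E4.ofTimeSpace 0 (y : E3) + σ • E4.basisVector 0 := by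
      rw [hjK, E4.ofTimeSpace_eq_smul_add, add_comm]
    have hT : Kerr.timeVector M a (jK y).1 = Kerr.timeVector M a (E4.ofTimeSpace 0 (y : E3)) := by
      rw [hx, Kerr.timeVector_add_smul_basisVector_zero]
    have hνeq : νK y = c • Kerr.timeVector M a (jK y).1 := by
      rw [hνK, Kerr.sliceNormal_apply, hT]
    show 𝒮.timeOrientation.IsFutureDirected (mfderiv 𝓘(ℝ, E4) (𝓡 4) (Ψ ∘ lab) (jK y) (νK y))
    rw [hdΦ, hνeq, map_smul]
    have hlin : mfderiv 𝓘(ℝ, E4) (𝓡 4) Ψ (lab (jK y)) (c • (mo.1 : E4 ≃L[ℝ] E4) (Kerr.timeVector M a (jK y).1)) =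
        c • mfderiv 𝓘(ℝ, E4) (𝓡 4) Ψ (lab (jK y)) ((mo.1 : E4 ≃L[ℝ] E4) (Kerr.timeVector M a (jK y).1)) :=
      ContinuousLinearMap.map_smul _ c _
    rw [hlin]
    exact hV.smul hcpos

/-- **`j` is a smooth embedding**: smooth (the chart is smooth on `Q`), injective differentials
(`dj = dΦ ∘ dj_K`, both injective), immersion by `isImmersion_of_injective_mfderiv`, and a topological
embedding (`Ψ|pullK Q` is an open embedding, `lab` and `j_K` are embeddings). [cite: ONeill1983, Ch. 3, Prop. 3.59] -/
theorem chart_isSmoothEmbedding (hM : 0 ≤ M) (hlab : ∀ z, (lab z : E4) = (mo.1 : E4 ≃L[ℝ] E4) z.1 + mo.2)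
    (hQ : IsOpen Q) (hB : B = starBackground mo.1 mo.2 M a (fun x => Kerr.radius a (poincareInv mo.1 mo.2 x)))
    (hs : ContMDiffOn 𝓘(ℝ, E4) (𝓡 4) ∞ Ψ (pullK mo M a B Q))
    (he : IsOpenEmbedding ((pullK mo M a B Q).restrict Ψ))
    (hd : supCkENorm (Subtype.val '' pullK mo M a B Q) 0 (𝒮.deviationExtend B Ψ) ≤ 0)
    (hN : N ≤ Kerr.slice a M) (hjK : ∀ y, (jK y : E4) = E4.ofTimeSpace σ (y : E3)) (hjQ : ∀ y, jK y ∈ Q)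
    (hνK : ∀ y, νK y = Kerr.sliceNormal M a M (Opens.inclusion hN y)) :
    Manifold.IsSmoothEmbedding (𝓡 3) (𝓡 4) ∞ (Ψ ∘ lab ∘ jK) := by
  have hemb := KerrLevel.level_isSmoothEmbedding hM σ hN hjK
  have hjKd : ∀ y, MDifferentiableAt 𝓘(ℝ, E3) 𝓘(ℝ, E4) jK y := fun y =>
    (hemb.contMDiff y).mdifferentiableAt (by simp)
  -- the level data embedding, for the injectivity of `dj_K`
  let 𝒮K : DataEmbedding ((Kerr.data M a M hM).comap (Opens.inclusion hN) (contMDiff_inclusion hN)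
      (KerrLevel.injective_mfderiv_inclusion hN)) :=
    { toSpacetime := Kerr.spacetime M a M hM
      embed := jK
      isSmoothEmbedding := hemb
      normal := νK
      isFutureUnitNormal := KerrLevel.level_isFutureUnitNormal hM σ hN hjK hνK
      induced_h := KerrLevel.level_induced_h hM σ hN hjK
      induced_k := by
        intro inst y
        haveI : (Kerr.smoothMetric M a M).HasLeviCivita := inst
        exact KerrLevel.level_induced_k hM σ hN hjK hνK y }
  have hc : ContMDiff (𝓡 3) (𝓡 4) ∞ (Ψ ∘ lab ∘ jK) := fun y =>
    (contMDiffAt_chart hlab hQ hB hs (hjQ y)).1.comp y (hemb.contMDiff y)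
  have hinj : ∀ y, Injective (mfderiv (𝓡 3) (𝓡 4) (Ψ ∘ lab ∘ jK) y) := by
    intro y v w hvw
    obtain ⟨hΦ, -⟩ := contMDiffAt_chart hlab hQ hB hs (hjQ y)
    rw [show Ψ ∘ lab ∘ jK = (Ψ ∘ lab) ∘ jK from rfl,
      mfderiv_comp y (hΦ.mdifferentiableAt (by simp)) (hjKd y)] at hvw
    have h0 : mfderiv 𝓘(ℝ, E4) (𝓡 4) (Ψ ∘ lab) (jK y)
        (mfderiv (𝓡 3) 𝓘(ℝ, E4) jK y v - mfderiv (𝓡 3) 𝓘(ℝ, E4) jK y w) = 0 := by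
      rw [map_sub, sub_eq_zero]; exact hvw
    have h1 := sub_eq_zero.1 (eq_zero_of_mfderiv_chart_eq_zero hlab hQ hB hs hd (hjQ y) h0)
    exact 𝒮K.mfderiv_embed_injective y h1
  refine ⟨Literature.Topology.FourManifolds.isImmersion_of_injective_mfderiv hc (by simp) hinj, ?_⟩
  -- topological embedding: `j = Ψ|pullK Q ∘ (y ↦ lab (j_K y))`
  have hlabe : IsEmbedding lab := by
    refine IsEmbedding.of_comp (contMDiff_lab hlab).1.continuous continuous_subtype_val ?_
    have : (Subtype.val ∘ lab) = (fun x : E4 => (mo.1 : E4 ≃L[ℝ] E4) x + mo.2) ∘ Subtype.val := funext hlab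
    rw [this]
    exact (((mo.1 : E4 ≃L[ℝ] E4).toHomeomorph.trans (Homeomorph.addRight mo.2)).isEmbedding).comp
      IsEmbedding.subtypeVal
  have hg : IsEmbedding (fun y => (⟨lab (jK y), (lab_mem_pullK_iff hlab (jK y)).2 (hjQ y)⟩ : pullK mo M a B Q)) :=
    (hlabe.comp hemb.isEmbedding).codRestrict _ _
  exact he.isEmbedding.comp hg

/-- **The second fundamental form of `(j, ν)` is the tensor of the sub-datum**:
`K^{g}_{j, ν} = (ι^* Kerr.data).k` — naturality of the second fundamental form under the equidimensional
immersion `Φ|Q = (Ψ ∘ lab)|Q` (`secondFundamentalForm_comap`; the pulled-back metric `Φ^* g` on the open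
sub-manifold `Q` is `g_{M,a}|Q` by the chart isometry), locality of the second fundamental form under
restriction to `Q` (the restricted metric is the pull-back along the inclusion, `restrict_eq_comap`),
and `KerrLevel.level_induced_k`. [cite: ONeill1983, Ch. 4, Lemma 4.4] -/
theorem chart_induced_k (hM : 0 ≤ M) (hlab : ∀ z, (lab z : E4) = (mo.1 : E4 ≃L[ℝ] E4) z.1 + mo.2)
    (hQ : IsOpen Q) (hB : B = starBackground mo.1 mo.2 M a (fun x => Kerr.radius a (poincareInv mo.1 mo.2 x)))
    (hs : ContMDiffOn 𝓘(ℝ, E4) (𝓡 4) ∞ Ψ (pullK mo M a B Q))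
    (hd : supCkENorm (Subtype.val '' pullK mo M a B Q) 0 (𝒮.deviationExtend B Ψ) ≤ 0)
    (hN : N ≤ Kerr.slice a M) (hjK : ∀ y, (jK y : E4) = E4.ofTimeSpace σ (y : E3)) (hjQ : ∀ y, jK y ∈ Q)
    (hνK : ∀ y, νK y = Kerr.sliceNormal M a M (Opens.inclusion hN y))
    [𝒮.metric.toPseudoRiemannianMetric.HasLeviCivita] (y : N) :
    𝒮.metric.toPseudoRiemannianMetric.secondFundamentalForm (𝓡 3) (Ψ ∘ lab ∘ jK)
        (fun y => mfderiv 𝓘(ℝ, E4) (𝓡 4) Ψ (lab (jK y)) ((mo.1 : E4 ≃L[ℝ] E4) (νK y))) y =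
      ((Kerr.data M a M hM).comap (Opens.inclusion hN) (contMDiff_inclusion hN)
        (KerrLevel.injective_mfderiv_inclusion hN)).kBilin y := by
  -- the open sub-manifold `Q` and the chart on it
  set Q' : Opens (Kerr.region a M) := ⟨Q, hQ⟩ with hQ'
  set ΦQ : Q' → 𝒮.carrier := fun q => (Ψ ∘ lab) q.1 with hΦQ_def
  have hΦQs : ContMDiff 𝓘(ℝ, E4) (𝓡 4) ∞ ΦQ := fun q =>
    (contMDiffAt_chart hlab hQ hB hs q.2).1.comp q (contMDiff_subtype_val q)
  have hΦQs' : ContMDiff 𝓘(ℝ, E4) (𝓡 4) ((∞ : ℕ∞ω) + 1) ΦQ := hΦQs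
  have hdΦQ : ∀ q : Q', mfderiv 𝓘(ℝ, E4) (𝓡 4) ΦQ q = mfderiv 𝓘(ℝ, E4) (𝓡 4) (Ψ ∘ lab) q.1 := fun q =>
    mfderiv_comp_subtypeVal ((contMDiffAt_chart hlab hQ hB hs q.2).1.mdifferentiableAt (by simp))
  have hΦQ' : ∀ q : Q', Injective (mfderiv 𝓘(ℝ, E4) (𝓡 4) ΦQ q) := by
    intro q
    rw [hdΦQ q]
    exact (injective_iff_map_eq_zero _).2 fun u hu => eq_zero_of_mfderiv_chart_eq_zero hlab hQ hB hs hd q.2 hu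
  -- the pulled-back metric on `Q` is the restricted Kerr metric
  set gc := 𝒮.metric.toPseudoRiemannianMetric.comap PseudoRiemannianMetric.contMDiff_pullbackBilin_holds
    ΦQ hΦQs' hΦQ' rfl with hgc_def
  set gK := (Kerr.smoothMetric M a M).toPseudoRiemannianMetric.restrict
    PseudoRiemannianMetric.contMDiff_restrict_holds Q' with hgK_def
  have hgc : gc = gK := by
    refine PseudoRiemannianMetric.ext (funext fun q => ?_)
    ext u u'
    change 𝒮.metric.val (ΦQ q) (mfderiv 𝓘(ℝ, E4) (𝓡 4) ΦQ q u) (mfderiv 𝓘(ℝ, E4) (𝓡 4) ΦQ q u') =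
      Kerr.bilin M a q.1.1 u u'
    rw [hdΦQ q]
    exact val_mfderiv_chart hlab hQ hB hs hd q.2 u u'
  -- the restricted Kerr metric is the pull-back along the inclusion
  set gi := (Kerr.smoothMetric M a M).toPseudoRiemannianMetric.comap
    PseudoRiemannianMetric.contMDiff_pullbackBilin_holds (Subtype.val : Q' → Kerr.region a M)
    contMDiff_subtype_val (injective_mfderiv_subtypeVal Q') rfl with hgi_def
  have hgi : gK = gi := PseudoRiemannianMetric.restrict_eq_comap _ Q'
  haveI hgcLC : gc.HasLeviCivita := gc.hasLeviCivita
  haveI hgKLC : gK.HasLeviCivita := gK.hasLeviCivita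
  haveI hgiLC : gi.HasLeviCivita := gi.hasLeviCivita
  haveI : (Kerr.smoothMetric M a M).toPseudoRiemannianMetric.HasLeviCivita :=
    (Kerr.smoothMetric M a M).toPseudoRiemannianMetric.hasLeviCivita
  -- `j_K` factored through `Q`, with its normal section
  set jKQ : N → Q' := fun y => ⟨jK y, hjQ y⟩ with hjKQ_def
  have hνsec : MDifferentiableAt 𝓘(ℝ, E3) 𝓘(ℝ, E4).tangent
      (fun x => (TotalSpace.mk' E4 (jKQ x) (νK x) : TangentBundle 𝓘(ℝ, E4) Q')) y :=
    (mdifferentiableAt_totalSpace_opens_iff Q').2 (KerrLevel.level_mdifferentiableAt_normal hM σ hN hjK hνK y)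
  -- (1) naturality under `Φ|Q`
  have key := PseudoRiemannianMetric.secondFundamentalForm_comap 𝒮.metric.toPseudoRiemannianMetric
    PseudoRiemannianMetric.contMDiff_pullbackBilin_holds (Φ := ΦQ) hΦQs' hΦQ' rfl (f := jKQ) (ν := νK)
    (y := y) BoundarylessManifold.isInteriorPoint hνsec
  have hcompj : (ΦQ ∘ jKQ) = Ψ ∘ lab ∘ jK := rfl
  have hcompν : (fun x => mfderiv 𝓘(ℝ, E4) (𝓡 4) ΦQ (jKQ x) (νK x)) =
      fun x => mfderiv 𝓘(ℝ, E4) (𝓡 4) Ψ (lab (jK x)) ((mo.1 : E4 ≃L[ℝ] E4) (νK x)) := by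
    funext x
    rw [hdΦQ]
    exact (contMDiffAt_chart hlab hQ hB hs (hjQ x)).2 (νK x)
  rw [hcompj, hcompν] at key
  rw [← key, PseudoRiemannianMetric.secondFundamentalForm_congr_metric hgc hgcLC hgKLC,
    PseudoRiemannianMetric.secondFundamentalForm_congr_metric hgi hgKLC hgiLC]
  -- (2) locality under restriction to `Q`
  have key2 := PseudoRiemannianMetric.secondFundamentalForm_comap
    (Kerr.smoothMetric M a M).toPseudoRiemannianMetric PseudoRiemannianMetric.contMDiff_pullbackBilin_holds
    (Φ := (Subtype.val : Q' → Kerr.region a M)) contMDiff_subtype_val (injective_mfderiv_subtypeVal Q') rfl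
    (f := jKQ) (ν := νK) (y := y) BoundarylessManifold.isInteriorPoint hνsec
  have hnormal : (fun x => mfderiv 𝓘(ℝ, E4) 𝓘(ℝ, E4) (Subtype.val : Q' → Kerr.region a M) (jKQ x) (νK x)) = νK := by
    funext x; rw [mfderiv_subtypeVal]; rfl
  rw [key2, hnormal]
  -- (3) the level data
  exact KerrLevel.level_induced_k hM σ hN hjK hνK y

end Hypersurface

end ChartData

/-- **Registered bookkeeping sub-goal `stub_exactChartDeviationZero` of the line** (brick of the landing
of K2b-5 `stub_marchingLemma`): exactness at order `0` on `pullK Q` means the metric deviation vanishes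
there pointwise (anchor of this file, whose content is the hypersurface datum carried by an exact chart,
`ChartData.chart_isSmoothEmbedding` / `_isFutureUnitNormal` / `_induced_h` / `_induced_k`). [folklore] -/
theorem stub_exactChartDeviationZero : ∀ (𝒮 : Spacetime.{0} 4) (mo : lorentzGroup × E4) (M a : ℝ)
    (B : ModelBackground) (Ψ : B.domain → 𝒮.carrier) (Q : Set (Kerr.region a M)) (x : B.domain),
    supCkENorm (Subtype.val '' pullK mo M a B Q) 0 (𝒮.deviationExtend B Ψ) ≤ 0 → x ∈ pullK mo M a B Q →
    𝒮.deviation B Ψ x = 0 :=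
  fun _ _ _ _ _ _ _ _ hd hx => ChartData.deviation_eq_zero_of_exact hd hx

end Summit.FinalStateConjecture.FinalStateConjecture.Theorems.BondiBartnikRigidity.DirectMethod

end
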